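import Summits.QuantumAdvantage.QuantumAdvantage.Theorems.CubicForrelationNearExactIsExactEightTypeEEnd
import Summits.QuantumAdvantage.QuantumAdvantage.Theorems.CubicForrelationNearExactIsExactEightTypeO
import Summits.QuantumAdvantage.QuantumAdvantage.Theorems.CubicForrelationNearExactIsExactThetaLadder

/-!
# Crux `CubicForrelation.NearExactIsExact` (stmt-QuantumAdvantage-14043) — **θ₈ = 13/16**: isolation above `13/16` on 8 bits

Certificate seat `b2b-cforr-cert` (generation 2).  HONEST FRAMING: a DECIDABLE VERDICT about the finite slice `n = 8` of the crux — NOT summit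
progress.  **`isolation_eight_1316`: for all cubic `f, g : 𝔽₂⁸ → 𝔽₂`, `Φ(f,g) > 13/16 ⇒ Φ(f,g) = 1`**, improving the tree's `isolation_eight`
(`7/8`); with the `𝔽₄`-pencil pair (`Φ = 13/16`, `tl8_forrelation_eq_card`) this gives **`theta_eight_isLeast`: `θ₈ = 13/16` exactly**.
Proof (seat folder `PROOF-N8.md`): `W_g = 8u` with `[u odd]` constant (`ed_parity_const`); type E (`u` even) is `typeE_isolation` (bent, or the
split-flat analysis `el_*`/`ep_*`/`te*_*` ending in the parity kill and the clean kill); type O for both `f` and `g` is capped at `13/16` by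
`typeO_pair_le_thirteen_sixteenths`; the mixed case is type E for `f` by the symmetry `Φ(f,g) = Φ(g,f)`.
-/

set_option linter.dupNamespace false -- D-0017: single-problem summit ⇒ `QuantumAdvantage.QuantumAdvantage` by design

noncomputable section

namespace Summit.QuantumAdvantage.QuantumAdvantage.Theorems.CubicForrelation.NearExactIsExact

open Finset
open Literature.Computability.QuantumComplexity
open Literature.Computability.QuantumComplexity.BuzetChailloux (bxor zeroVec)
open Literature.Computability.QuantumComplexity.DerivativeWalsh (W)

/-- **Type E above `13/16` is exact.** For cubic `f, g` on 8 bits with `W_g = 16v`: `Φ(f,g) > 13/16 ⇒ Φ(f,g) = 1`. [this work] -/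
theorem typeE_isolation (f g : (Fin (4 + 4) → Bool) → Bool) (hf : IsDegLeFun 3 f) (hg : IsDegLeFun 3 g)
    (v : (Fin (4 + 4) → Bool) → ℤ) (hv : ∀ x, W (fun y => signOf (g y)) x = (2 : ℝ) ^ 4 * (v x : ℝ))
    (hΦ : 13 / 16 < forrelation f g) : forrelation f g = 1 := by
  classical
  by_cases hall : ∀ x, Odd (v x)
  · -- every Walsh value is `±16·odd`: Parseval forces `W² = 256`, `g` is bent
    have hP := eow_parseval g
    have hge : ∀ x ∈ (univ : Finset (Fin (4 + 4) → Bool)), (256 : ℝ) ≤ W (fun y => signOf (g y)) x ^ 2 := by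
      intro x _
      rw [hv x]
      have h1 := Int.odd_iff.1 (hall x)
      have hz : (v x : ℝ) ≤ -1 ∨ 1 ≤ (v x : ℝ) := by
        rcases (show v x ≤ -1 ∨ 1 ≤ v x by omega) with h | h
        · left; exact_mod_cast h
        · right; exact_mod_cast h
      rcases hz with h | h <;> nlinarith
    have hsum : ∑ x, (W (fun y => signOf (g y)) x ^ 2 - 256) = 0 := by
      rw [sum_sub_distrib, hP, sum_const, card_univ, Fintype.card_fun, Fintype.card_bool, Fintype.card_fin]; norm_num
    have hz := (sum_eq_zero_iff_of_nonneg fun x hx => sub_nonneg.2 (hge x hx)).1 hsum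
    have hbent : ∀ x, W (fun y => signOf (g y)) x ^ 2 = (2 : ℝ) ^ (4 + 4) := by
      intro x; have h := hz x (mem_univ x); rw [show (2 : ℝ) ^ (4 + 4) = 256 by norm_num]; linarith
    rcases tw_bent_end (m := 4) (by norm_num) f g hf hg hbent with h | h
    · exact h
    · exfalso; norm_num at h; linarith
  · push Not at hall
    obtain ⟨x₁, hx₁⟩ := hall
    have hN := el_card_odd_eq f g hg v hv hΦ ⟨x₁, hx₁⟩
    have hq2 : IsDegLeFun 2 (fun x => !decide (Odd (v x))) := (el_parity_deg g v hg hv).not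
    have hfq : (univ.filter fun x : Fin (4 + 4) → Bool => (!decide (Odd (v x))) = true) = univ.filter fun x => ¬ Odd (v x) :=
      filter_congr fun x _ => by simp
    have h64 : #(univ.filter fun x : Fin (4 + 4) → Bool => (!decide (Odd (v x))) = true) = 64 := by
      rw [hfq]
      have := card_filter_add_card_filter_not (s := (univ : Finset (Fin (4 + 4) → Bool))) (fun x => Odd (v x))
      rw [hN, card_univ, Fintype.card_fun, Fintype.card_bool, Fintype.card_fin] at this
      simp only [Nat.reducePow, Nat.reduceAdd] at this
      exact Nat.add_left_cancel (this.trans (by norm_num))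
    obtain ⟨h0, hadd, hcard, hcos⟩ := el_flat_of_quadratic _ hq2 h64
    have hZ := hcos x₁ (by simpa using hx₁)
    rw [hfq] at hZ
    have hfp := ep_partner f g hf hg v hv hΦ _ x₁ h0 hadd hcard hZ hN
    have hA := tee_char f g hf hg v hv _ x₁ h0 hadd hcard hZ hfp
    obtain ⟨hvals, hcnt⟩ := tee_pi_shape f g v hv hΦ hN hfp
    exfalso
    by_cases hne : ∃ y, (v y - sZ (f y) + (if Odd (v y) then 0 else sZ (decide (Odd (v y / 2)) ^^ f y))) ≠ 0
    · exact tef_parity f g hf (fun y => v y - sZ (f y) + (if Odd (v y) then 0 else sZ (decide (Odd (v y / 2)) ^^ f y))) _ hA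
        (fun y => tef_fourier f g v hv _ x₁ hZ y) hvals hcnt hne
    · push Not at hne
      exact tef_clean f g v hv hN _ hA (fun y => tef_W_flat f v _ x₁ hZ y) hne

/-- **Isolation at `13/16` on `8` bits.** For all cubic `f, g : 𝔽₂⁸ → 𝔽₂`, `Φ(f,g) > 13/16 ⇒ Φ(f,g) = 1` — tight (`Φ = 13/16` is attained by the
`𝔽₄`-pencil pair, `tl8_forrelation_eq_card`); improves the tree's `isolation_eight` (`7/8`).  Finite-slice verdict; NOT summit progress. [this work] -/
theorem isolation_eight_1316 :
    ∀ f g : (Fin (4 + 4) → Bool) → Bool, IsDegLeFun 3 f → IsDegLeFun 3 g →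
      13 / 16 < forrelation f g → forrelation f g = 1 := by
  intro f g hf hg hΦ
  obtain ⟨u, hu⟩ := tw_base g hg 3 (by norm_num)
  obtain ⟨u', hu'⟩ := tw_base f hf 3 (by norm_num)
  by_cases hgE : ∀ x, ¬ Odd (u x)
  · exact typeE_isolation f g hf hg (fun x => u x / 2) (tw_level_up g u hu hgE) hΦ
  · push Not at hgE
    obtain ⟨x₀, hx₀⟩ := hgE
    have hgO : ∀ x, Odd (u x) := fun x => (ed_parity_const g u hg hu x x₀).2 hx₀
    by_cases hfE : ∀ y, ¬ Odd (u' y)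
    · have h := typeE_isolation g f hg hf (fun y => u' y / 2) (tw_level_up f u' hu' hfE) (by rwa [Summit.QuantumAdvantage.QuantumAdvantage.Theorems.SignedCubicForrelationNotPrBPP.Negative.HalfQuad.forrelation_comm])
      rwa [Summit.QuantumAdvantage.QuantumAdvantage.Theorems.SignedCubicForrelationNotPrBPP.Negative.HalfQuad.forrelation_comm] at h
    · push Not at hfE
      obtain ⟨y₀, hy₀⟩ := hfE
      have hfO : ∀ y, Odd (u' y) := fun y => (ed_parity_const f u' hf hu' y y₀).2 hy₀
      have hle := typeO_pair_le_thirteen_sixteenths f g hf hg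
        (fun x => by obtain ⟨k, hk⟩ := hgO x; exact ⟨k, by rw [hu x, hk]; push_cast; ring⟩)
        (fun y => by obtain ⟨k, hk⟩ := hfO y; exact ⟨k, by rw [hu' y, hk]; push_cast; ring⟩)
      linarith

/-- **`θ₈ = 13/16` exactly**: `13/16` is the least threshold isolating exactness for cubic pairs on 8 bits (isolation above it:
`isolation_eight_1316`; nothing smaller isolates: the `𝔽₄`-pencil pair has `Φ = 13/16 ≠ 1`).  Closes the `n = 8` slot of the certified ladder
(`theta_eight_bounds` had `[13/16, 7/8]`).  Finite-slice DECIDABLE VERDICT; NOT summit progress. [this work] -/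
theorem theta_eight_isLeast :
    IsLeast {θ : ℝ | ∀ f g : (Fin 8 → Bool) → Bool, IsDegLeFun 3 f → IsDegLeFun 3 g →
      θ < forrelation f g → forrelation f g = 1} (13 / 16) :=
  ⟨fun f g hf hg h => isolation_eight_1316 f g hf hg h, fun θ hθ => theta_eight_bounds.2 θ hθ⟩

end Summit.QuantumAdvantage.QuantumAdvantage.Theorems.CubicForrelation.NearExactIsExact

end
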